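import Mathlib
import Summits.ValiantsHypothesis.ValiantsHypothesis.Theorems.DivisionGapDefs
import Summits.ValiantsHypothesis.ValiantsHypothesis.Theorems.DivisionGapPerMultiplesHardStubRectangleBound
import Summits.ValiantsHypothesis.ValiantsHypothesis.Theorems.DivisionGapPerMultiplesHardPushOff
import Literature.Barriers.ValiantsHypothesis.MonotoneGapParseTrees
import Literature.Computability.AlgebraicComplexity.PermanentIrreducible

/-!
# `DivisionGap.PerCofactorDegreeReduction` (stmt-ValiantsHypothesis-15046), line
`intrinsic-member-descent`: intrinsic Jerrum–Snir for face permanents (stub `stub_intrinsicJS`)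

For a host `G ⊆ [n] × [n]` (`3 ≤ n`) containing a perfect matching, write
`per_G = facePer G = Σ_{σ ⊆ G} x^{μ_σ}` (cells `(σ i, i)`: `σ` maps the COLUMN `i` to the ROW `σ i`)
and `#PM(G)` for the number of permutations inside `G`.  We prove the balanced-split inequality

  `#PM(G) ≤ L⁺(per_G) · #{σ ⊆ G : σ(T) = S}`

for some rows `S` and columns `T` with `n < 3|S| ≤ 2n`, `|S| = |T|`.

Proof.  The generic rectangle engine `PerMultiplesHard.RectangleBound.stub_rectangleBound` at
`g = per_G` (all margins `1`) yields `a, b ≠ 0` with `supp (a · b) ⊆ supp per_G`,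
`#supp per_G ≤ L⁺(per_G) · #supp a · #supp b`, and `a` torus-homogeneous with margins `(ρ, γ)`,
`n < 3 · #{ρ ≠ 0} ≤ 2n`.  Put `S := {ρ ≠ 0}`, `T := {γ ≠ 0}`.  Over `ℝ≥0` there is no cancellation
(`JerrumSnir.support_mul_eq`: `supp (a · b) = supp a + supp b`), so every `α + β`
(`α ∈ supp a`, `β ∈ supp b`) is a permutation monomial `μ_σ`, `σ ⊆ G`.  Hence `ρ, γ` are
`0/1`-valued (so `|S| = Σ ρ = deg α = Σ γ = |T|`), `α` is the restriction of `μ_σ` to the rows `S`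
(so `(α, β) ↦ α + β` is injective on `supp a × supp b`), and `σ` maps `T` onto `S`.  Finally
`#supp per_G = #PM(G)` as `σ ↦ μ_σ` is injective.

References: Jerrum–Snir 1982 §4 (the permanent), Jukna 2023 (Lemma 3.5, balanced rectangles).
-/

noncomputable section

-- the namespace is mandated by the crux (`Summit.ValiantsHypothesis.ValiantsHypothesis.…`)
set_option linter.dupNamespace false

open MvPolynomial Literature.Computability.AlgebraicComplexity
open Summit.ValiantsHypothesis.ValiantsHypothesis.Theorems.DivisionGapPerDivisionHard (facePer)
open scoped NNReal

namespace Summit.ValiantsHypothesis.ValiantsHypothesis.Theorems.DivisionGap.PerCofactorDegreeReduction.IntrinsicJS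

variable {n : ℕ}

/-! ### The face permanent: support, margins, monomial count -/

/-- Support of the face permanent `per_G`: exactly the permutation monomials `μ_σ`, `σ ⊆ G`
(`PushOff.mem_support_facePer`, restated for the named polynomial `facePer G`). [folklore] -/
theorem mem_support_facePer_iff (G : Finset (Fin n × Fin n)) (d : (Fin n × Fin n) →₀ ℕ) :
    d ∈ (facePer G).support ↔
      ∃ σ : Equiv.Perm (Fin n), (∀ i, (σ i, i) ∈ G) ∧ permMonomial σ = d :=
  Summit.ValiantsHypothesis.ValiantsHypothesis.Theorems.DivisionGap.PerMultiplesHard.PushOff.mem_support_facePer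

/-- The support of `per_G` is the image `σ ↦ μ_σ` of the permutations inside `G`. [folklore] -/
theorem support_facePer_eq_image (G : Finset (Fin n × Fin n)) :
    (facePer G).support =
      ((Finset.univ : Finset (Equiv.Perm (Fin n))).filter (fun σ => ∀ i, (σ i, i) ∈ G)).image
        permMonomial := by
  ext d
  rw [mem_support_facePer_iff, Finset.mem_image]
  simp only [Finset.mem_filter, Finset.mem_univ, true_and]

/-- `#mon(per_G) = #PM(G)`: the monomials of the face permanent are in bijection with the
permutations inside `G` (`permMonomial_injective`). [folklore] -/
theorem card_support_facePer (G : Finset (Fin n × Fin n)) :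
    (facePer G).support.card =
      ((Finset.univ : Finset (Equiv.Perm (Fin n))).filter (fun σ => ∀ i, (σ i, i) ∈ G)).card := by
  rw [support_facePer_eq_image, Finset.card_image_of_injective _ permMonomial_injective]

/-- Row sums of a permutation monomial are `1`. [folklore] -/
theorem rowsum_permMonomial (σ : Equiv.Perm (Fin n)) (i : Fin n) :
    ∑ j, permMonomial σ (i, j) = 1 :=
  rowCount_permMonomial σ i

/-- Column sums of a permutation monomial are `1`. [folklore] -/
theorem colsum_permMonomial (σ : Equiv.Perm (Fin n)) (j : Fin n) :
    ∑ i, permMonomial σ (i, j) = 1 :=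
  colCount_permMonomial σ j

/-- `per_G` is torus-homogeneous with all row and column margins equal to `1`. [folklore] -/
theorem margins_facePer (G : Finset (Fin n × Fin n)) :
    ∀ m ∈ (facePer G).support,
      (∀ i, ∑ j, m (i, j) = (fun _ : Fin n => 1) i) ∧ (∀ j, ∑ i, m (i, j) = (fun _ : Fin n => 1) j) := by
  intro m hm
  obtain ⟨σ, -, rfl⟩ := (mem_support_facePer_iff G m).1 hm
  exact ⟨rowsum_permMonomial σ, colsum_permMonomial σ⟩

/-- A host with a perfect matching has a nonzero face permanent. [folklore] -/
theorem facePer_ne_zero (G : Finset (Fin n × Fin n))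
    (hG : ∃ σ : Equiv.Perm (Fin n), ∀ i, (σ i, i) ∈ G) : facePer G ≠ 0 := by
  obtain ⟨σ, hσ⟩ := hG
  intro h0
  have hmem : permMonomial σ ∈ (facePer G).support :=
    (mem_support_facePer_iff G _).2 ⟨σ, hσ, rfl⟩
  rw [h0, MvPolynomial.support_zero] at hmem
  exact Finset.notMem_empty _ hmem

/-! ### Summands of a permutation monomial -/

section Summand

variable {α β : (Fin n × Fin n) →₀ ℕ} {τ : Equiv.Perm (Fin n)}

/-- If `α + β = μ_τ` and `α` uses the cell `(i, j)`, then `τ j = i`. [folklore] -/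
theorem perm_apply_eq_of_ne_zero (h : α + β = permMonomial τ) {i j : Fin n}
    (hij : α (i, j) ≠ 0) : τ j = i := by
  have hle : α (i, j) ≤ permMonomial τ (i, j) := by
    rw [← h, Finsupp.add_apply]; exact Nat.le_add_right _ _
  rw [permMonomial_apply] at hle
  by_contra hne
  rw [if_neg hne, Nat.le_zero] at hle
  exact hij hle

/-- A summand of a permutation monomial has row sums `≤ 1`. [folklore] -/
theorem rowsum_le_one (h : α + β = permMonomial τ) (i : Fin n) : ∑ j, α (i, j) ≤ 1 := by
  calc ∑ j, α (i, j) ≤ ∑ j, permMonomial τ (i, j) :=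
        Finset.sum_le_sum fun j _ => by rw [← h, Finsupp.add_apply]; exact Nat.le_add_right _ _
    _ = 1 := rowsum_permMonomial τ i

/-- A summand of a permutation monomial has column sums `≤ 1`. [folklore] -/
theorem colsum_le_one (h : α + β = permMonomial τ) (j : Fin n) : ∑ i, α (i, j) ≤ 1 := by
  calc ∑ i, α (i, j) ≤ ∑ i, permMonomial τ (i, j) :=
        Finset.sum_le_sum fun i _ => by rw [← h, Finsupp.add_apply]; exact Nat.le_add_right _ _
    _ = 1 := colsum_permMonomial τ j

/-- The summand `α` of `α + β = μ_τ` is the restriction of `μ_τ` to the rows where `α` has a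
nonzero row sum: a row of `μ_τ` carries a single `1`, so a nonzero sub-row is the whole row.
[folklore] -/
theorem summand_apply_eq (h : α + β = permMonomial τ) (i j : Fin n) :
    α (i, j) = if ∑ j', α (i, j') = 0 then 0 else permMonomial τ (i, j) := by
  split_ifs with hi
  · exact (Finset.sum_eq_zero_iff.1 hi) j (Finset.mem_univ j)
  · have hle : ∀ j' ∈ (Finset.univ : Finset (Fin n)), α (i, j') ≤ permMonomial τ (i, j') :=
      fun j' _ => by rw [← h, Finsupp.add_apply]; exact Nat.le_add_right _ _
    have hsum : ∑ j', α (i, j') = ∑ j', permMonomial τ (i, j') := by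
      refine le_antisymm (Finset.sum_le_sum hle) ?_
      rw [rowsum_permMonomial]
      exact Nat.pos_of_ne_zero hi
    exact (Finset.sum_eq_sum_iff_of_le hle).1 hsum j (Finset.mem_univ j)

end Summand

/-! ### The rectangle of the engine injects into the split-respecting matchings -/

/-- In a rectangle `supp a + supp b ⊆ mon(per_G)` (no cancellation over `ℝ≥0`), every sum
`α + β` is a permutation monomial inside `G`. [folklore] -/
theorem exists_perm_of_mem_rectangle (G : Finset (Fin n × Fin n))
    (a b : MvPolynomial (Fin n × Fin n) ℝ≥0) (hsub : (a * b).support ⊆ (facePer G).support)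
    {α β : (Fin n × Fin n) →₀ ℕ} (hα : α ∈ a.support) (hβ : β ∈ b.support) :
    ∃ σ : Equiv.Perm (Fin n), (∀ i, (σ i, i) ∈ G) ∧ permMonomial σ = α + β := by
  classical
  refine (mem_support_facePer_iff G _).1 (hsub ?_)
  rw [Literature.Barriers.ValiantsHypothesis.JerrumSnir.support_mul_eq]
  exact Finset.add_mem_add hα hβ

/-- **The balanced split has as many rows as columns.**  If `a ≠ 0`, `b ≠ 0`,
`supp (a · b) ⊆ mon(per_G)` and `a` has margins `(ρ, γ)`, then `ρ, γ` are `0/1`-valued and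
`#{ρ ≠ 0} = Σ ρ = Σ γ = #{γ ≠ 0}` (both equal the degree of any monomial of `a`). [folklore] -/
theorem card_rows_eq_card_cols (G : Finset (Fin n × Fin n))
    (a b : MvPolynomial (Fin n × Fin n) ℝ≥0) (ρ γ : Fin n → ℕ) (S T : Finset (Fin n))
    (hS : ∀ i, i ∈ S ↔ ρ i ≠ 0) (hT : ∀ j, j ∈ T ↔ γ j ≠ 0) (ha : a ≠ 0) (hb : b ≠ 0)
    (hsub : (a * b).support ⊆ (facePer G).support)
    (hty : ∀ m ∈ a.support, (∀ i, ∑ j, m (i, j) = ρ i) ∧ (∀ j, ∑ i, m (i, j) = γ j)) :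
    S.card = T.card := by
  classical
  obtain ⟨α, hα⟩ := MvPolynomial.support_nonempty.2 ha
  obtain ⟨β, hβ⟩ := MvPolynomial.support_nonempty.2 hb
  obtain ⟨σ, -, hσ⟩ := exists_perm_of_mem_rectangle G a b hsub hα hβ
  obtain ⟨hρ, hγ⟩ := hty α hα
  -- `ρ`, `γ` are `0/1`-valued
  have hρ1 : ∀ i, ρ i ≤ 1 := fun i => by rw [← hρ i]; exact rowsum_le_one hσ.symm i
  have hγ1 : ∀ j, γ j ≤ 1 := fun j => by rw [← hγ j]; exact colsum_le_one hσ.symm j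
  have hS' : S = Finset.univ.filter fun i => ρ i ≠ 0 := by
    ext i
    simp only [Finset.mem_filter, Finset.mem_univ, true_and]
    exact hS i
  have hT' : T = Finset.univ.filter fun j => γ j ≠ 0 := by
    ext j
    simp only [Finset.mem_filter, Finset.mem_univ, true_and]
    exact hT j
  calc S.card = ∑ i, ρ i := by
        rw [hS', Finset.card_filter]
        refine Finset.sum_congr rfl fun i _ => ?_
        have := hρ1 i
        split_ifs with h <;> omega
    _ = ∑ i, ∑ j, α (i, j) := Finset.sum_congr rfl fun i _ => (hρ i).symm
    _ = ∑ j, ∑ i, α (i, j) := Finset.sum_comm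
    _ = ∑ j, γ j := Finset.sum_congr rfl fun j _ => hγ j
    _ = T.card := by
        rw [hT', Finset.card_filter]
        refine Finset.sum_congr rfl fun j _ => ?_
        have := hγ1 j
        split_ifs with h <;> omega

/-- **The rectangle injects into the split-respecting matchings.**  If `supp (a · b) ⊆ mon(per_G)`
and `a` has margins `(ρ, γ)`, `S = {ρ ≠ 0}`, `T = {γ ≠ 0}`, then
`#supp a · #supp b ≤ #{σ ⊆ G : σ(T) = S}`: the map `(α, β) ↦ σ` with `μ_σ = α + β` is injective
(`α` is the restriction of `μ_σ` to the rows `S`, `summand_apply_eq`) and `σ` maps the columns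
used by `α` onto the rows used by `α`. [folklore] -/
theorem card_rectangle_le (G : Finset (Fin n × Fin n))
    (a b : MvPolynomial (Fin n × Fin n) ℝ≥0) (ρ γ : Fin n → ℕ) (S T : Finset (Fin n))
    (hS : ∀ i, i ∈ S ↔ ρ i ≠ 0) (hT : ∀ j, j ∈ T ↔ γ j ≠ 0)
    (hsub : (a * b).support ⊆ (facePer G).support)
    (hty : ∀ m ∈ a.support, (∀ i, ∑ j, m (i, j) = ρ i) ∧ (∀ j, ∑ i, m (i, j) = γ j)) :
    a.support.card * b.support.card ≤
      ((Finset.univ : Finset (Equiv.Perm (Fin n))).filter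
        (fun σ : Equiv.Perm (Fin n) => (∀ i, (σ i, i) ∈ G) ∧ T.image ⇑σ = S)).card := by
  classical
  rw [← Finset.card_product]
  calc (a.support ×ˢ b.support).card
      ≤ (((Finset.univ : Finset (Equiv.Perm (Fin n))).filter
          (fun σ : Equiv.Perm (Fin n) => (∀ i, (σ i, i) ∈ G) ∧ T.image ⇑σ = S)).image
            permMonomial).card := by
        refine Finset.card_le_card_of_injOn (fun p => p.1 + p.2) ?_ ?_
        · -- the sum map lands in the permutation monomials of split-respecting matchings
          intro p hp
          rw [Finset.mem_coe, Finset.mem_product] at hp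
          obtain ⟨σ, hσG, hσ⟩ := exists_perm_of_mem_rectangle G a b hsub hp.1 hp.2
          obtain ⟨hρ, hγ⟩ := hty p.1 hp.1
          refine Finset.mem_coe.2 (Finset.mem_image.2
            ⟨σ, Finset.mem_filter.2 ⟨Finset.mem_univ _, hσG, ?_⟩, hσ⟩)
          ext i
          rw [Finset.mem_image]
          constructor
          · rintro ⟨j, hj, rfl⟩
            -- column `j` is used by `α = p.1`, in some row `i'`; then `σ j = i'` and `ρ i' ≠ 0`
            have hγj : ∑ i', p.1 (i', j) ≠ 0 := by rw [hγ j]; exact (hT j).1 hj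
            obtain ⟨i', -, hi'⟩ := Finset.exists_ne_zero_of_sum_ne_zero hγj
            rw [perm_apply_eq_of_ne_zero hσ.symm hi', hS]
            intro hρ0
            exact hi' ((Finset.sum_eq_zero_iff.1 ((hρ i').trans hρ0)) j (Finset.mem_univ _))
          · intro hi
            -- row `i` is used by `α = p.1`, in some column `j`; then `γ j ≠ 0` and `σ j = i`
            have hρi : ∑ j, p.1 (i, j) ≠ 0 := by rw [hρ i]; exact (hS i).1 hi
            obtain ⟨j, -, hj⟩ := Finset.exists_ne_zero_of_sum_ne_zero hρi
            refine ⟨j, ?_, perm_apply_eq_of_ne_zero hσ.symm hj⟩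
            rw [hT]
            intro hγ0
            exact hj ((Finset.sum_eq_zero_iff.1 ((hγ j).trans hγ0)) i (Finset.mem_univ _))
        · -- injectivity on the rectangle: `α` is determined by `α + β` (and `ρ`), then cancel
          rintro ⟨α₁, β₁⟩ h₁ ⟨α₂, β₂⟩ h₂ heq
          have heq' : α₁ + β₁ = α₂ + β₂ := heq
          rw [Finset.mem_coe, Finset.mem_product] at h₁ h₂
          obtain ⟨σ, -, hσ⟩ := exists_perm_of_mem_rectangle G a b hsub h₁.1 h₁.2
          have hσ₁ : α₁ + β₁ = permMonomial σ := hσ.symm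
          have hσ₂ : α₂ + β₂ = permMonomial σ := heq'.symm.trans hσ₁
          have hα : α₁ = α₂ := by
            ext ⟨i, j⟩
            rw [summand_apply_eq hσ₁ i j, summand_apply_eq hσ₂ i j, (hty α₁ h₁.1).1 i,
              (hty α₂ h₂.1).1 i]
          subst hα
          rw [add_left_cancel heq']
    _ = _ := Finset.card_image_of_injective _ permMonomial_injective

/-! ### The stub -/

/-- **Intrinsic Jerrum–Snir for face permanents** (registered stub `stub_intrinsicJS` of the line
`intrinsic-member-descent`).  For every host `G` with a perfect matching (`n ≥ 3`) there is a
balanced split `(S, T)` (`n/3 < |S| = |T| ≤ 2n/3`) with `#PM(G) ≤ L⁺(per_G) · #PM(G; T → S)`,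
where `#PM(G; T → S)` counts the perfect matchings of `G` mapping the columns `T` onto the rows `S`.
Route: `RectangleBound.stub_rectangleBound` at `g = per_G` (margins `1`): the typed factor `a` has
`0/1` row type supported on `S` and column type supported on `T`, and `(α, β) ↦ α + β` injects
`supp a × supp b` into the split-respecting matchings. [cite: JerrumSnir1982, §4] -/
theorem stub_intrinsicJS :
    ∀ (n : ℕ), 3 ≤ n → ∀ (G : Finset (Fin n × Fin n)),
      (∃ σ : Equiv.Perm (Fin n), ∀ i, (σ i, i) ∈ G) →
      ∃ S T : Finset (Fin n), n < 3 * S.card ∧ 3 * S.card ≤ 2 * n ∧ S.card = T.card ∧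
        ((Finset.univ : Finset (Equiv.Perm (Fin n))).filter (fun σ => ∀ i, (σ i, i) ∈ G)).card ≤
          complexity (facePer G) *
            ((Finset.univ : Finset (Equiv.Perm (Fin n))).filter
              (fun σ : Equiv.Perm (Fin n) => (∀ i, (σ i, i) ∈ G) ∧ T.image ⇑σ = S)).card := by
  intro n hn G hG
  obtain ⟨a, b, ha, hb, -, -, hsub, hcard, ρ, γ, hty, hlo, hhi⟩ :=
    Summit.ValiantsHypothesis.ValiantsHypothesis.Theorems.DivisionGap.PerMultiplesHard.RectangleBound.stub_rectangleBound
      n hn (facePer G) (fun _ => 1) (fun _ => 1) (margins_facePer G) (fun _ => one_ne_zero)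
      (facePer_ne_zero G hG)
  have hS : ∀ i, i ∈ (Finset.univ.filter fun i => ρ i ≠ 0) ↔ ρ i ≠ 0 := fun i => by
    simp only [Finset.mem_filter, Finset.mem_univ, true_and]
  have hT : ∀ j, j ∈ (Finset.univ.filter fun j => γ j ≠ 0) ↔ γ j ≠ 0 := fun j => by
    simp only [Finset.mem_filter, Finset.mem_univ, true_and]
  refine ⟨Finset.univ.filter (fun i => ρ i ≠ 0), Finset.univ.filter (fun j => γ j ≠ 0), hlo, hhi,
    card_rows_eq_card_cols G a b ρ γ _ _ hS hT ha hb hsub hty, ?_⟩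
  rw [← card_support_facePer]
  exact hcard.trans (Nat.mul_le_mul_left _ (card_rectangle_le G a b ρ γ _ _ hS hT hsub hty))

end Summit.ValiantsHypothesis.ValiantsHypothesis.Theorems.DivisionGap.PerCofactorDegreeReduction.IntrinsicJS

end
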